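import Literature.AnabelianGeometry.EtaleTheta.Discharge.Sec5TowerOfConnectedTemperoid
import Literature.AnabelianGeometry.EtaleTheta.Discharge.Sec5Thm57OfBiKummerFamily
import Literature.AnabelianGeometry.SemiGraphs.CosetCategoriesSlimTempered

/-!
# [EtTh] §5, Theorem 5.7 at ALL levels for the GENUINE CONNECTED-BASE tower `ofConnectedTemperoidFamily` (pp. 329–331 / PDF pp. 103–105)

Mochizuki, *The étale theta function …*, Publ. RIMS **45** (2009)
[cite: MochizukiEtTh2009, Thm 5.7 p.330 (PDF p.104); Rmk 4.3.2 p.318–319 (PDF pp.92–93)].  Seat abc-iut-L2-d4 (gen 4; node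
`EtTh:Thm5.7`); PROOF-ONLY re-point of this seat's capstone `thetaRootPreservedAll_ofBiKummerFamily`
(`Discharge/Sec5Thm57OfBiKummerFamily.lean`, p422809) to abc-iut-L2-t4's §5 tower over the GENUINE connected base
`D := B^temp(Π^tp_X)⁰ = ConnectedPart (BTemp X.Pi)` (`ThetaFrobenioidTower.ofConnectedTemperoidFamily`,
`Discharge/Sec5TowerOfConnectedTemperoid.lean`; ROW W3-L2-01 «§5 GENUINE DATA»).

WHAT IS DISCHARGED HERE relative to p422809 (every item a theorem of the tree, consumed BY NAME):
* `hσ` (`Base(s^trv_N(g)) = g`) := `ThetaFrobenioid.baseMap_strvOfBiKummerData` — `s^trv_N` is CONSTRUCTED ([FrdI] Prop. 5.6);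
* `hfrac`, `haut` (the dictionary `toB := id` is compatible with fractions and the birational `Aut`-action) :=
  `BiKummerSetting.coe_fracOfModel_mul_unit`, `BiKummerSetting.coe_biratAutModel_eq_pull` (abc-iut-L2-t9/t4);
* `hopen`, `hdivc`/`hdivp` (from `hinvc`/`hinvp`), `ρ_comm_β` — inside `ofConnectedTemperoidFamily` (abc-iut-L2-t4);
* `hD` ("`D` of FSM-type") := `QuasiTemperoid.BTempConnected.connectedPart_isOfFSMType` ([FrdII] Ex. 1.3, abc-iut-L1);
* `hslim` ("`D` slim") := `TemperedArithmeticGroup.isSlim_connectedPart` ([SemiAnbd] Rmk. 3.4.1 + [FrdI] §0 p. 14, this seat's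
  `SemiGraphs/CosetCategoriesSlimTempered.lean`: `Π^tp_X` is tempered and temp-slim, [SemiAnbd] Ex. 3.10).
WHAT REMAINS (binders, unchanged in meaning from p422809): `hH` (`Π^tp_Ÿ ⊆ H_⊙`; a theorem for the §5 choice `A_⊙^bs := Ÿ`,
abc-iut-L2-t4's `BiKummerSetting.hH_mkOfConnectedTemperoidYddTower`), `hnd`, `hN` (abstract `tf`: `Φ` non-dilating, some
object not group-like — [EtTh] Thm. 3.7 (i)(ii), Rmk. 3.7.2), `hK₁` (Lemma 5.8's arithmetic step at level `1`; a theorem from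
`hconst` + `hgc` by abc-iut-L2-t4's `facts_atLevel_ofConnectedTemperoidFamily`), `hdiv` (Prop. 5.3 (vi) at every `A_N`), `hdesc`
(Rmk. 4.3.2 descent of the identifications), `hnat` (naturality of the constants along `β_{1,N}`), `hfac₁` (GAP G-L2d4-1),
`hθ₁` (Thm. 4.4 (iv) / Prop. 2.4 transport data at level `1`), `hc` (the ONE anabelian residual: the level-`1` discrepancy
constant is a `2l`-th root of unity).
HONEST FRAMING: a kernel-checked implication for data so parametrised (the class `TemperedFrobenioid T₀ (ConnectedPart (BTemp
X.Pi)) VD` is not shown inhabited here); nothing asserts any result of [EtTh] unconditionally; typed ≠ discharged; no side taken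
on anything downstream. -/

noncomputable section

namespace Literature.AnabelianGeometry.EtaleTheta

open CategoryTheory Opposite Literature.AlgebraicGeometry.Frobenioids Literature.AnabelianGeometry.SemiGraphs
  Literature.AnabelianGeometry.SemiGraphs.GaloisObjects

universe u₀ v₀ w

namespace ThetaFrobenioidTower

variable {K : Type u₀} [Field K] {X : SemiGraphs.TemperedArithmeticGroup.{u₀} K} {D₀ : Type u₀} [Category.{v₀} D₀]
  {V : FrdIMonoidStub.{w}} {T₀ : RealifiedDivisorMonoids (D₀ := D₀) V}
  {VD : FrdICatStub.{u₀ + 1, u₀, w} (ConnectedPart (BTemp X.Pi))}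
  {tf : TemperedFrobenioid T₀ (ConnectedPart (BTemp X.Pi)) VD} {hZ : tf.monoidType = MonoidType.Z}
  {hP : ∀ A : (ConnectedPart (BTemp X.Pi))ᵒᵖ, IsPerfect (tf.Φ.carrier A)}
  {NH : Subgroup (Field.absoluteGaloisGroup K) → tf.category → ℕ+ → Prop} {A₀ : tf.category}
  {hA₀ : PreFrobenioid.IsFrobeniusTrivial tf.toElem A₀} {hA₀' : SemiGraphs.IsGaloisObj A₀.base.obj}
  {pullFrac : ∀ {A A' : (BiKummerSetting.mkOfConnectedTemperoid X tf hZ hP NH A₀ hA₀ hA₀').C} (_ : A' ⟶ A),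
    (BiKummerSetting.mkOfConnectedTemperoid X tf hZ hP NH A₀ hA₀ hA₀').biratUnits A →
      (BiKummerSetting.mkOfConnectedTemperoid X tf hZ hP NH A₀ hA₀ hA₀').biratUnits A'}
  {lv : ℕ+} {E : Set ℕ+} {𝒯 : ThetaEnvTower.{max u₀ w} E}
  {θ : (BiKummerSetting.mkOfConnectedTemperoid X tf hZ hP NH A₀ hA₀ hA₀').biratUnits
    (BiKummerSetting.mkOfConnectedTemperoid X tf hZ hP NH A₀ hA₀ hA₀').Aodot}
  {Bl : (BiKummerSetting.mkOfConnectedTemperoid X tf hZ hP NH A₀ hA₀ hA₀').C}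
  {Pl : (BiKummerSetting.mkOfConnectedTemperoid X tf hZ hP NH A₀ hA₀ hA₀').FractionPair θ Bl}
  {Rl : (BiKummerSetting.mkOfConnectedTemperoid X tf hZ hP NH A₀ hA₀ hA₀').NthRoot θ Pl lv pullFrac}
  (h : ModelFrobenioid.Hypotheses tf.divisorMonoid tf.ratFnFunctor)
  (Q : FrobenioidTheta.ThetaSubquotientStub.{w} (ConnectedPart (BTemp X.Pi))) (odd_l : Odd (lv : ℕ))
  (R : ∀ N : ℕ+, (BiKummerSetting.mkOfConnectedTemperoid X tf hZ hP NH A₀ hA₀ hA₀').NthRoot Rl.root Rl.pair N pullFrac)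
  (ιX : 𝒯.PiX ≃ₜ* X.Pi) (K' : Type w) [Field K'] (constEmb : ∀ N : ℕ+, K'ˣ →* tf.biratUnitsModel (R N).BN)
  (constEmb_injective : ∀ N : ℕ+, Function.Injective (constEmb N))
  (hinvc : ∀ (N : ℕ+) (g : Aut (R N).AN.base),
    pull tf.divisorMonoid g.hom (ModelFrobenioid.div (R N).pair.num) = ModelFrobenioid.div (R N).pair.num)
  (hinvp : ∀ (N : ℕ+) (y : 𝒯.PiX), y ∈ 𝒯.PiYdd →
    pull tf.divisorMonoid ((BiKummerSetting.mkOfConnectedTemperoid X tf hZ hP NH A₀ hA₀ hA₀').galoisSurj (R N).AN.base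
      (R N).αData.isGalois (ιX y)).hom (ModelFrobenioid.div (R N).pair.den) = ModelFrobenioid.div (R N).pair.den)
  (α : ∀ {N N' : ℕ+}, (N : ℕ) ∣ N' → ((R N').AN ⟶ (R N).AN))
  (β : ∀ {N N' : ℕ+}, (N : ℕ) ∣ N' → ((R N').BN ⟶ (R N).BN))
  (comm_sCap : ∀ {N N' : ℕ+} (hd : (N : ℕ) ∣ N'), (R N').pair.num ≫ β hd = α hd ≫ (R N).pair.num)
  (comm_sCup : ∀ {N N' : ℕ+} (hd : (N : ℕ) ∣ N'), (R N').pair.den ≫ β hd = α hd ≫ (R N).pair.den)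
  (isIsometry_α : ∀ {N N' : ℕ+} (hd : (N : ℕ) ∣ N'),
    ((BiKummerSetting.mkOfConnectedTemperoid X tf hZ hP NH A₀ hA₀ hA₀').sec5Stub h).pre.IsIsometry (α hd))
  (degFr_α : ∀ {N N' : ℕ+} (hd : (N : ℕ) ∣ N'),
    (((BiKummerSetting.mkOfConnectedTemperoid X tf hZ hP NH A₀ hA₀ hA₀').sec5Stub h).pre.degFr (α hd) : ℕ) * N = N')
  (isIsometry_β : ∀ {N N' : ℕ+} (hd : (N : ℕ) ∣ N'),
    ((BiKummerSetting.mkOfConnectedTemperoid X tf hZ hP NH A₀ hA₀ hA₀').sec5Stub h).pre.IsIsometry (β hd))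
  (degFr_β : ∀ {N N' : ℕ+} (hd : (N : ℕ) ∣ N'),
    (((BiKummerSetting.mkOfConnectedTemperoid X tf hZ hP NH A₀ hA₀ hA₀').sec5Stub h).pre.degFr (β hd) : ℕ) * N = N')
  (baseFrob_α : ∀ {N N' : ℕ+} (hd : (N : ℕ) ∣ N'),
    (BiKummerSetting.mkOfConnectedTemperoid X tf hZ hP NH A₀ hA₀ hA₀').IsOfBaseFrobeniusType (α hd))

include h in
/-- **[EtTh] Theorem 5.7 (root level) at ALL levels for the §5 tower over the GENUINE connected base `B^temp(Π^tp_X)⁰`**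
(`ofConnectedTemperoidFamily`), modulo exactly `hH` and the inputs listed in the module docstring (`hnd`, `hN`; `hK₁`; `hdiv`;
`hdesc`; `hnat`; `hfac₁`; `hθ₁`; `hc`) — `hσ`, `hfrac`, `haut`, "`D` of FSM-type" and "`D` slim" DISCHARGED.
[cite: MochizukiEtTh2009, Thm 5.7 p.329–330 (PDF pp.103–104); Rmk 4.3.2 p.318–319 (PDF pp.92–93); Lem 5.8 p.331 (PDF p.105)] -/
theorem thetaRootPreservedAll_ofConnectedTemperoidFamily
    (hH : ∀ y : 𝒯.PiX, y ∈ 𝒯.PiYdd → ιX y ∈ (BiKummerSetting.mkOfConnectedTemperoid X tf hZ hP NH A₀ hA₀ hA₀').Hodot)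
    (hnd : IsNonDilatingOn tf.divisorMonoid)
    (hN : ∃ A : (BiKummerSetting.mkOfConnectedTemperoid X tf hZ hP NH A₀ hA₀ hA₀').C, ¬ (PreFrobenioidData.ofModel tf.divisorMonoid tf.ratFnFunctor tf.divBNatTrans).IsGroupLikeObj A)
    (hK₁ : ((ofConnectedTemperoidFamily h Q odd_l R ιX K' constEmb constEmb_injective hinvc hinvp α β comm_sCap comm_sCup
      isIsometry_α degFr_α isIsometry_β degFr_β baseFrob_α).atLevel 1).ConstantsActByCyclotome)
    (Ψ : (BiKummerSetting.mkOfConnectedTemperoid X tf hZ hP NH A₀ hA₀ hA₀').C ≌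
      (BiKummerSetting.mkOfConnectedTemperoid X tf hZ hP NH A₀ hA₀ hA₀').C)
    (hdiv : ∀ (N : ℕ+) (α' : Ψ.functor.obj ((ofConnectedTemperoidFamily h Q odd_l R ιX K' constEmb constEmb_injective hinvc hinvp α β comm_sCap comm_sCup
      isIsometry_α degFr_α isIsometry_β degFr_β baseFrob_α).AN N) ≅ (ofConnectedTemperoidFamily h Q odd_l R ιX K' constEmb constEmb_injective hinvc hinvp α β comm_sCap comm_sCup
      isIsometry_α degFr_α isIsometry_β degFr_β baseFrob_α).AN N) (β' : Ψ.functor.obj ((ofConnectedTemperoidFamily h Q odd_l R ιX K' constEmb constEmb_injective hinvc hinvp α β comm_sCap comm_sCup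
      isIsometry_α degFr_α isIsometry_β degFr_β baseFrob_α).BN N) ≅ (ofConnectedTemperoidFamily h Q odd_l R ιX K' constEmb constEmb_injective hinvc hinvp α β comm_sCap comm_sCup
      isIsometry_α degFr_α isIsometry_β degFr_β baseFrob_α).BN N),
      ∃ e : (ofConnectedTemperoidFamily h Q odd_l R ιX K' constEmb constEmb_injective hinvc hinvp α β comm_sCap comm_sCup
      isIsometry_α degFr_α isIsometry_β degFr_β baseFrob_α).AN N ≅ (ofConnectedTemperoidFamily h Q odd_l R ιX K' constEmb constEmb_injective hinvc hinvp α β comm_sCap comm_sCup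
      isIsometry_α degFr_α isIsometry_β degFr_β baseFrob_α).AN N,
        (ofConnectedTemperoidFamily h Q odd_l R ιX K' constEmb constEmb_injective hinvc hinvp α β comm_sCap comm_sCup
      isIsometry_α degFr_α isIsometry_β degFr_β baseFrob_α).pre.div (α'.inv ≫ Ψ.functor.map ((ofConnectedTemperoidFamily h Q odd_l R ιX K' constEmb constEmb_injective hinvc hinvp α β comm_sCap comm_sCup
      isIsometry_α degFr_α isIsometry_β degFr_β baseFrob_α).sCap N) ≫ β'.hom) = (ofConnectedTemperoidFamily h Q odd_l R ιX K' constEmb constEmb_injective hinvc hinvp α β comm_sCap comm_sCup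
      isIsometry_α degFr_α isIsometry_β degFr_β baseFrob_α).pre.div (e.hom ≫ (ofConnectedTemperoidFamily h Q odd_l R ιX K' constEmb constEmb_injective hinvc hinvp α β comm_sCap comm_sCup
      isIsometry_α degFr_α isIsometry_β degFr_β baseFrob_α).sCap N) ∧
        (ofConnectedTemperoidFamily h Q odd_l R ιX K' constEmb constEmb_injective hinvc hinvp α β comm_sCap comm_sCup
      isIsometry_α degFr_α isIsometry_β degFr_β baseFrob_α).pre.div (α'.inv ≫ Ψ.functor.map ((ofConnectedTemperoidFamily h Q odd_l R ιX K' constEmb constEmb_injective hinvc hinvp α β comm_sCap comm_sCup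
      isIsometry_α degFr_α isIsometry_β degFr_β baseFrob_α).sCup N) ≫ β'.hom) = (ofConnectedTemperoidFamily h Q odd_l R ιX K' constEmb constEmb_injective hinvc hinvp α β comm_sCap comm_sCup
      isIsometry_α degFr_α isIsometry_β degFr_β baseFrob_α).pre.div (e.hom ≫ (ofConnectedTemperoidFamily h Q odd_l R ιX K' constEmb constEmb_injective hinvc hinvp α β comm_sCap comm_sCup
      isIsometry_α degFr_α isIsometry_β degFr_β baseFrob_α).sCup N))
    (hdesc : ∀ (N : ℕ+) (α' : Ψ.functor.obj ((ofConnectedTemperoidFamily h Q odd_l R ιX K' constEmb constEmb_injective hinvc hinvp α β comm_sCap comm_sCup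
      isIsometry_α degFr_α isIsometry_β degFr_β baseFrob_α).AN N) ≅ (ofConnectedTemperoidFamily h Q odd_l R ιX K' constEmb constEmb_injective hinvc hinvp α β comm_sCap comm_sCup
      isIsometry_α degFr_α isIsometry_β degFr_β baseFrob_α).AN N) (β' : Ψ.functor.obj ((ofConnectedTemperoidFamily h Q odd_l R ιX K' constEmb constEmb_injective hinvc hinvp α β comm_sCap comm_sCup
      isIsometry_α degFr_α isIsometry_β degFr_β baseFrob_α).BN N) ≅ (ofConnectedTemperoidFamily h Q odd_l R ιX K' constEmb constEmb_injective hinvc hinvp α β comm_sCap comm_sCup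
      isIsometry_α degFr_α isIsometry_β degFr_β baseFrob_α).BN N)
      (e : (ofConnectedTemperoidFamily h Q odd_l R ιX K' constEmb constEmb_injective hinvc hinvp α β comm_sCap comm_sCup
      isIsometry_α degFr_α isIsometry_β degFr_β baseFrob_α).AN N ≅ (ofConnectedTemperoidFamily h Q odd_l R ιX K' constEmb constEmb_injective hinvc hinvp α β comm_sCap comm_sCup
      isIsometry_α degFr_α isIsometry_β degFr_β baseFrob_α).AN N) (Dc Dp : Aut ((ofConnectedTemperoidFamily h Q odd_l R ιX K' constEmb constEmb_injective hinvc hinvp α β comm_sCap comm_sCup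
      isIsometry_α degFr_α isIsometry_β degFr_β baseFrob_α).BN N)),
      α'.inv ≫ Ψ.functor.map ((ofConnectedTemperoidFamily h Q odd_l R ιX K' constEmb constEmb_injective hinvc hinvp α β comm_sCap comm_sCup
      isIsometry_α degFr_α isIsometry_β degFr_β baseFrob_α).sCap N) ≫ β'.hom = e.hom ≫ (ofConnectedTemperoidFamily h Q odd_l R ιX K' constEmb constEmb_injective hinvc hinvp α β comm_sCap comm_sCup
      isIsometry_α degFr_α isIsometry_β degFr_β baseFrob_α).sCap N ≫ Dc.hom →
      α'.inv ≫ Ψ.functor.map ((ofConnectedTemperoidFamily h Q odd_l R ιX K' constEmb constEmb_injective hinvc hinvp α β comm_sCap comm_sCup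
      isIsometry_α degFr_α isIsometry_β degFr_β baseFrob_α).sCup N) ≫ β'.hom = e.hom ≫ (ofConnectedTemperoidFamily h Q odd_l R ιX K' constEmb constEmb_injective hinvc hinvp α β comm_sCap comm_sCup
      isIsometry_α degFr_α isIsometry_β degFr_β baseFrob_α).sCup N ≫ Dp.hom →
      ∃ (α₁ : Ψ.functor.obj ((ofConnectedTemperoidFamily h Q odd_l R ιX K' constEmb constEmb_injective hinvc hinvp α β comm_sCap comm_sCup
      isIsometry_α degFr_α isIsometry_β degFr_β baseFrob_α).AN 1) ≅ (ofConnectedTemperoidFamily h Q odd_l R ιX K' constEmb constEmb_injective hinvc hinvp α β comm_sCap comm_sCup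
      isIsometry_α degFr_α isIsometry_β degFr_β baseFrob_α).AN 1) (β₁ : Ψ.functor.obj ((ofConnectedTemperoidFamily h Q odd_l R ιX K' constEmb constEmb_injective hinvc hinvp α β comm_sCap comm_sCup
      isIsometry_α degFr_α isIsometry_β degFr_β baseFrob_α).BN 1) ≅ (ofConnectedTemperoidFamily h Q odd_l R ιX K' constEmb constEmb_injective hinvc hinvp α β comm_sCap comm_sCup
      isIsometry_α degFr_α isIsometry_β degFr_β baseFrob_α).BN 1)
        (e₁ : (ofConnectedTemperoidFamily h Q odd_l R ιX K' constEmb constEmb_injective hinvc hinvp α β comm_sCap comm_sCup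
      isIsometry_α degFr_α isIsometry_β degFr_β baseFrob_α).AN 1 ≅ (ofConnectedTemperoidFamily h Q odd_l R ιX K' constEmb constEmb_injective hinvc hinvp α β comm_sCap comm_sCup
      isIsometry_α degFr_α isIsometry_β degFr_β baseFrob_α).AN 1),
        α'.inv ≫ Ψ.functor.map ((ofConnectedTemperoidFamily h Q odd_l R ιX K' constEmb constEmb_injective hinvc hinvp α β comm_sCap comm_sCup
      isIsometry_α degFr_α isIsometry_β degFr_β baseFrob_α).α (one_dvd_level N)) ≫ α₁.hom = (ofConnectedTemperoidFamily h Q odd_l R ιX K' constEmb constEmb_injective hinvc hinvp α β comm_sCap comm_sCup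
      isIsometry_α degFr_α isIsometry_β degFr_β baseFrob_α).α (one_dvd_level N) ∧
        β'.inv ≫ Ψ.functor.map ((ofConnectedTemperoidFamily h Q odd_l R ιX K' constEmb constEmb_injective hinvc hinvp α β comm_sCap comm_sCup
      isIsometry_α degFr_α isIsometry_β degFr_β baseFrob_α).β (one_dvd_level N)) ≫ β₁.hom = (ofConnectedTemperoidFamily h Q odd_l R ιX K' constEmb constEmb_injective hinvc hinvp α β comm_sCap comm_sCup
      isIsometry_α degFr_α isIsometry_β degFr_β baseFrob_α).β (one_dvd_level N) ∧
        (ofConnectedTemperoidFamily h Q odd_l R ιX K' constEmb constEmb_injective hinvc hinvp α β comm_sCap comm_sCup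
      isIsometry_α degFr_α isIsometry_β degFr_β baseFrob_α).α (one_dvd_level N) ≫ e₁.hom = e.hom ≫ (ofConnectedTemperoidFamily h Q odd_l R ιX K' constEmb constEmb_injective hinvc hinvp α β comm_sCap comm_sCup
      isIsometry_α degFr_α isIsometry_β degFr_β baseFrob_α).α (one_dvd_level N) ∧
        (ofConnectedTemperoidFamily h Q odd_l R ιX K' constEmb constEmb_injective hinvc hinvp α β comm_sCap comm_sCup
      isIsometry_α degFr_α isIsometry_β degFr_β baseFrob_α).pre.div (α₁.inv ≫ Ψ.functor.map ((ofConnectedTemperoidFamily h Q odd_l R ιX K' constEmb constEmb_injective hinvc hinvp α β comm_sCap comm_sCup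
      isIsometry_α degFr_α isIsometry_β degFr_β baseFrob_α).sCap 1) ≫ β₁.hom) = (ofConnectedTemperoidFamily h Q odd_l R ιX K' constEmb constEmb_injective hinvc hinvp α β comm_sCap comm_sCup
      isIsometry_α degFr_α isIsometry_β degFr_β baseFrob_α).pre.div (e₁.hom ≫ (ofConnectedTemperoidFamily h Q odd_l R ιX K' constEmb constEmb_injective hinvc hinvp α β comm_sCap comm_sCup
      isIsometry_α degFr_α isIsometry_β degFr_β baseFrob_α).sCap 1) ∧
        (ofConnectedTemperoidFamily h Q odd_l R ιX K' constEmb constEmb_injective hinvc hinvp α β comm_sCap comm_sCup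
      isIsometry_α degFr_α isIsometry_β degFr_β baseFrob_α).pre.div (α₁.inv ≫ Ψ.functor.map ((ofConnectedTemperoidFamily h Q odd_l R ιX K' constEmb constEmb_injective hinvc hinvp α β comm_sCap comm_sCup
      isIsometry_α degFr_α isIsometry_β degFr_β baseFrob_α).sCup 1) ≫ β₁.hom) = (ofConnectedTemperoidFamily h Q odd_l R ιX K' constEmb constEmb_injective hinvc hinvp α β comm_sCap comm_sCup
      isIsometry_α degFr_α isIsometry_β degFr_β baseFrob_α).pre.div (e₁.hom ≫ (ofConnectedTemperoidFamily h Q odd_l R ιX K' constEmb constEmb_injective hinvc hinvp α β comm_sCap comm_sCup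
      isIsometry_α degFr_α isIsometry_β degFr_β baseFrob_α).sCup 1))
    (hnat : ∀ (N : ℕ+) (c : K'ˣ),
      (tf.ratFnFunctor.map (ModelFrobenioid.baseMap (β (one_dvd_level N))).op).hom
          ((constEmb 1 c : tf.biratUnitsModel (R 1).BN) : tf.ratFnFunctor.obj (op (R 1).BN.base)) =
        ((constEmb N c : tf.biratUnitsModel (R N).BN) : tf.ratFnFunctor.obj (op (R N).BN.base)))
    (hfac₁ : ∀ y ∈ ((ofConnectedTemperoidFamily h Q odd_l R ιX K' constEmb constEmb_injective hinvc hinvp α β comm_sCap comm_sCup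
      isIsometry_α degFr_α isIsometry_β degFr_β baseFrob_α).atLevel 1).imPiY, ∃ x ∈ ((ofConnectedTemperoidFamily h Q odd_l R ιX K' constEmb constEmb_injective hinvc hinvp α β comm_sCap comm_sCup
      isIsometry_α degFr_α isIsometry_β degFr_β baseFrob_α).atLevel 1).HB, ∀ u ∈ ((ofConnectedTemperoidFamily h Q odd_l R ιX K' constEmb constEmb_injective hinvc hinvp α β comm_sCap comm_sCup
      isIsometry_α degFr_α isIsometry_β degFr_β baseFrob_α).atLevel 1).units ((ofConnectedTemperoidFamily h Q odd_l R ιX K' constEmb constEmb_injective hinvc hinvp α β comm_sCap comm_sCup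
      isIsometry_α degFr_α isIsometry_β degFr_β baseFrob_α).BN 1),
      (ofConnectedTemperoidFamily h Q odd_l R ιX K' constEmb constEmb_injective hinvc hinvp α β comm_sCap comm_sCup
      isIsometry_α degFr_α isIsometry_β degFr_β baseFrob_α).sgpCap 1 y * u * ((ofConnectedTemperoidFamily h Q odd_l R ιX K' constEmb constEmb_injective hinvc hinvp α β comm_sCap comm_sCup
      isIsometry_α degFr_α isIsometry_β degFr_β baseFrob_α).sgpCap 1 y)⁻¹ = (ofConnectedTemperoidFamily h Q odd_l R ιX K' constEmb constEmb_injective hinvc hinvp α β comm_sCap comm_sCup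
      isIsometry_α degFr_α isIsometry_β degFr_β baseFrob_α).sgpCap 1 x * u * ((ofConnectedTemperoidFamily h Q odd_l R ιX K' constEmb constEmb_injective hinvc hinvp α β comm_sCap comm_sCup
      isIsometry_α degFr_α isIsometry_β degFr_β baseFrob_α).sgpCap 1 x)⁻¹)
    (hθ₁ : ∀ (α₁ : Ψ.functor.obj ((ofConnectedTemperoidFamily h Q odd_l R ιX K' constEmb constEmb_injective hinvc hinvp α β comm_sCap comm_sCup
      isIsometry_α degFr_α isIsometry_β degFr_β baseFrob_α).AN 1) ≅ (ofConnectedTemperoidFamily h Q odd_l R ιX K' constEmb constEmb_injective hinvc hinvp α β comm_sCap comm_sCup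
      isIsometry_α degFr_α isIsometry_β degFr_β baseFrob_α).AN 1) (β₁ : Ψ.functor.obj ((ofConnectedTemperoidFamily h Q odd_l R ιX K' constEmb constEmb_injective hinvc hinvp α β comm_sCap comm_sCup
      isIsometry_α degFr_α isIsometry_β degFr_β baseFrob_α).BN 1) ≅ (ofConnectedTemperoidFamily h Q odd_l R ιX K' constEmb constEmb_injective hinvc hinvp α β comm_sCap comm_sCup
      isIsometry_α degFr_α isIsometry_β degFr_β baseFrob_α).BN 1)
      (e₁ : (ofConnectedTemperoidFamily h Q odd_l R ιX K' constEmb constEmb_injective hinvc hinvp α β comm_sCap comm_sCup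
      isIsometry_α degFr_α isIsometry_β degFr_β baseFrob_α).AN 1 ≅ (ofConnectedTemperoidFamily h Q odd_l R ιX K' constEmb constEmb_injective hinvc hinvp α β comm_sCap comm_sCup
      isIsometry_α degFr_α isIsometry_β degFr_β baseFrob_α).AN 1) (Dc₁ Dp₁ : Aut ((ofConnectedTemperoidFamily h Q odd_l R ιX K' constEmb constEmb_injective hinvc hinvp α β comm_sCap comm_sCup
      isIsometry_α degFr_α isIsometry_β degFr_β baseFrob_α).BN 1)),
      α₁.inv ≫ Ψ.functor.map ((ofConnectedTemperoidFamily h Q odd_l R ιX K' constEmb constEmb_injective hinvc hinvp α β comm_sCap comm_sCup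
      isIsometry_α degFr_α isIsometry_β degFr_β baseFrob_α).sCap 1) ≫ β₁.hom = e₁.hom ≫ (ofConnectedTemperoidFamily h Q odd_l R ιX K' constEmb constEmb_injective hinvc hinvp α β comm_sCap comm_sCup
      isIsometry_α degFr_α isIsometry_β degFr_β baseFrob_α).sCap 1 ≫ Dc₁.hom →
      α₁.inv ≫ Ψ.functor.map ((ofConnectedTemperoidFamily h Q odd_l R ιX K' constEmb constEmb_injective hinvc hinvp α β comm_sCap comm_sCup
      isIsometry_α degFr_α isIsometry_β degFr_β baseFrob_α).sCup 1) ≫ β₁.hom = e₁.hom ≫ (ofConnectedTemperoidFamily h Q odd_l R ιX K' constEmb constEmb_injective hinvc hinvp α β comm_sCap comm_sCup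
      isIsometry_α degFr_α isIsometry_β degFr_β baseFrob_α).sCup 1 ≫ Dp₁.hom →
      ∃ θ₁ : Aut ((ofConnectedTemperoidFamily h Q odd_l R ιX K' constEmb constEmb_injective hinvc hinvp α β comm_sCap comm_sCup
      isIsometry_α degFr_α isIsometry_β degFr_β baseFrob_α).pre.base.obj ((ofConnectedTemperoidFamily h Q odd_l R ιX K' constEmb constEmb_injective hinvc hinvp α β comm_sCap comm_sCup
      isIsometry_α degFr_α isIsometry_β degFr_β baseFrob_α).BN 1)) ≃* Aut ((ofConnectedTemperoidFamily h Q odd_l R ιX K' constEmb constEmb_injective hinvc hinvp α β comm_sCap comm_sCup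
      isIsometry_α degFr_α isIsometry_β degFr_β baseFrob_α).pre.base.obj ((ofConnectedTemperoidFamily h Q odd_l R ιX K' constEmb constEmb_injective hinvc hinvp α β comm_sCap comm_sCup
      isIsometry_α degFr_α isIsometry_β degFr_β baseFrob_α).BN 1)),
        ((ofConnectedTemperoidFamily h Q odd_l R ιX K' constEmb constEmb_injective hinvc hinvp α β comm_sCap comm_sCup
      isIsometry_α degFr_α isIsometry_β degFr_β baseFrob_α).atLevel 1).StrvTransport Ψ α₁ e₁ θ₁ ∧
        ((ofConnectedTemperoidFamily h Q odd_l R ιX K' constEmb constEmb_injective hinvc hinvp α β comm_sCap comm_sCup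
      isIsometry_α degFr_α isIsometry_β degFr_β baseFrob_α).atLevel 1).HB.map θ₁.toMonoidHom = ((ofConnectedTemperoidFamily h Q odd_l R ιX K' constEmb constEmb_injective hinvc hinvp α β comm_sCap comm_sCup
      isIsometry_α degFr_α isIsometry_β degFr_β baseFrob_α).atLevel 1).HB)
    (hc : ∀ (α₁ : Ψ.functor.obj ((ofConnectedTemperoidFamily h Q odd_l R ιX K' constEmb constEmb_injective hinvc hinvp α β comm_sCap comm_sCup
      isIsometry_α degFr_α isIsometry_β degFr_β baseFrob_α).AN 1) ≅ (ofConnectedTemperoidFamily h Q odd_l R ιX K' constEmb constEmb_injective hinvc hinvp α β comm_sCap comm_sCup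
      isIsometry_α degFr_α isIsometry_β degFr_β baseFrob_α).AN 1) (β₁ : Ψ.functor.obj ((ofConnectedTemperoidFamily h Q odd_l R ιX K' constEmb constEmb_injective hinvc hinvp α β comm_sCap comm_sCup
      isIsometry_α degFr_α isIsometry_β degFr_β baseFrob_α).BN 1) ≅ (ofConnectedTemperoidFamily h Q odd_l R ιX K' constEmb constEmb_injective hinvc hinvp α β comm_sCap comm_sCup
      isIsometry_α degFr_α isIsometry_β degFr_β baseFrob_α).BN 1)
      (e₁ : (ofConnectedTemperoidFamily h Q odd_l R ιX K' constEmb constEmb_injective hinvc hinvp α β comm_sCap comm_sCup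
      isIsometry_α degFr_α isIsometry_β degFr_β baseFrob_α).AN 1 ≅ (ofConnectedTemperoidFamily h Q odd_l R ιX K' constEmb constEmb_injective hinvc hinvp α β comm_sCap comm_sCup
      isIsometry_α degFr_α isIsometry_β degFr_β baseFrob_α).AN 1) (Dc₁ Dp₁ : Aut ((ofConnectedTemperoidFamily h Q odd_l R ιX K' constEmb constEmb_injective hinvc hinvp α β comm_sCap comm_sCup
      isIsometry_α degFr_α isIsometry_β degFr_β baseFrob_α).BN 1)),
      α₁.inv ≫ Ψ.functor.map ((ofConnectedTemperoidFamily h Q odd_l R ιX K' constEmb constEmb_injective hinvc hinvp α β comm_sCap comm_sCup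
      isIsometry_α degFr_α isIsometry_β degFr_β baseFrob_α).sCap 1) ≫ β₁.hom = e₁.hom ≫ (ofConnectedTemperoidFamily h Q odd_l R ιX K' constEmb constEmb_injective hinvc hinvp α β comm_sCap comm_sCup
      isIsometry_α degFr_α isIsometry_β degFr_β baseFrob_α).sCap 1 ≫ Dc₁.hom →
      α₁.inv ≫ Ψ.functor.map ((ofConnectedTemperoidFamily h Q odd_l R ιX K' constEmb constEmb_injective hinvc hinvp α β comm_sCap comm_sCup
      isIsometry_α degFr_α isIsometry_β degFr_β baseFrob_α).sCup 1) ≫ β₁.hom = e₁.hom ≫ (ofConnectedTemperoidFamily h Q odd_l R ιX K' constEmb constEmb_injective hinvc hinvp α β comm_sCap comm_sCup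
      isIsometry_α degFr_α isIsometry_β degFr_β baseFrob_α).sCup 1 ≫ Dp₁.hom →
      ∀ (hu₁ : Dc₁⁻¹ * Dp₁ ∈ ((ofConnectedTemperoidFamily h Q odd_l R ιX K' constEmb constEmb_injective hinvc hinvp α β comm_sCap comm_sCup
      isIsometry_α degFr_α isIsometry_β degFr_β baseFrob_α).atLevel 1).units ((ofConnectedTemperoidFamily h Q odd_l R ιX K' constEmb constEmb_injective hinvc hinvp α β comm_sCap comm_sCup
      isIsometry_α degFr_α isIsometry_β degFr_β baseFrob_α).BN 1)) (c : (ofConnectedTemperoidFamily h Q odd_l R ιX K' constEmb constEmb_injective hinvc hinvp α β comm_sCap comm_sCup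
      isIsometry_α degFr_α isIsometry_β degFr_β baseFrob_α).Kˣ),
        ((ofConnectedTemperoidFamily h Q odd_l R ιX K' constEmb constEmb_injective hinvc hinvp α β comm_sCap comm_sCup
      isIsometry_α degFr_α isIsometry_β degFr_β baseFrob_α).atLevel 1).unitsToBirat ((ofConnectedTemperoidFamily h Q odd_l R ιX K' constEmb constEmb_injective hinvc hinvp α β comm_sCap comm_sCup
      isIsometry_α degFr_α isIsometry_β degFr_β baseFrob_α).BN 1) ⟨Dc₁⁻¹ * Dp₁, hu₁⟩ = (ofConnectedTemperoidFamily h Q odd_l R ιX K' constEmb constEmb_injective hinvc hinvp α β comm_sCap comm_sCup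
      isIsometry_α degFr_α isIsometry_β degFr_β baseFrob_α).constEmb 1 c → c ^ (2 * (ofConnectedTemperoidFamily h Q odd_l R ιX K' constEmb constEmb_injective hinvc hinvp α β comm_sCap comm_sCup
      isIsometry_α degFr_α isIsometry_β degFr_β baseFrob_α).l) = 1) :
    (ofConnectedTemperoidFamily h Q odd_l R ιX K' constEmb constEmb_injective hinvc hinvp α β comm_sCap comm_sCup
      isIsometry_α degFr_α isIsometry_β degFr_β baseFrob_α).ThetaRootPreservedAll Ψ := by
  delta ofConnectedTemperoidFamily at hK₁ hdiv hdesc hfac₁ hθ₁ hc ⊢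
  refine thetaRootPreservedAll_ofBiKummerFamily (S := BiKummerSetting.mkOfConnectedTemperoid X tf hZ hP NH A₀ hA₀ hA₀')
    h _ Q odd_l R ιX
    (fun N => BiKummerSetting.mkOfConnectedTemperoid_isOpen_ker_galoisSurj X tf hZ hP NH A₀ hA₀ hA₀' (R N).AN.base
      (R N).αData.isGalois)
    _ K' constEmb constEmb_injective
    (fun N => ThetaFrobenioid.hdivc_of_pull_invariant h.isDivisorial (R N) (ThetaFrobenioid.strvOfBiKummerData h (R N))
      (ThetaFrobenioid.baseMap_strvOfBiKummerData h (R N)) (hinvc N))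
    (div_strv_comp_den_connFamily h R ιX hinvp)
    α β comm_sCap comm_sCup isIsometry_α degFr_α isIsometry_β degFr_β baseFrob_α
    (fun hd => rho_comm_β_of_natural R ιX
      (BiKummerSetting.mkOfConnectedTemperoid_galoisSurj_natural X tf hZ hP NH A₀ hA₀ hA₀') α β comm_sCap hd)
    ?_ hH ?_ ?_ ?_ ?_ hnd hN hK₁ Ψ hdiv hdesc hnat hfac₁ hθ₁ hc
  · exact fun N g => ThetaFrobenioid.baseMap_strvOfBiKummerData h (R N) g
  · exact fun s' s'' _ _ _ => BiKummerSetting.coe_fracOfModel_mul_unit tf T₀.isUnit_BΛ s' s''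
  · exact fun e x => BiKummerSetting.coe_biratAutModel_eq_pull tf e x
  · exact QuasiTemperoid.BTempConnected.connectedPart_isOfFSMType
  · exact SemiGraphs.TemperedArithmeticGroup.isSlim_connectedPart X

end ThetaFrobenioidTower

end Literature.AnabelianGeometry.EtaleTheta

end
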